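import Literature.Analysis.FunctionSpaces.TorusClassicalNSGluing
import Literature.Analysis.FunctionSpaces.TorusCalculusProofs
import Literature.Analysis.FunctionSpaces.TorusSpaceTime
import Literature.Analysis.FunctionSpaces.TorusTestFunction
import HarnessLib

/-!
# Galilean change of frame on the flat torus — transport of test fields

Analysis/FluidPDE support file (all proved), companion of `LerayHopfGalileanTorusTools` (slice calculus of
the velocity) and `LerayHopfGalileanTorusWeak` (covariance of the weak formulation).  For a constant velocity
`V ∈ ℝ^d` write `[tV] := proj (t • V) ∈ T^d`.  Testing a velocity field seen from the frame moving with
velocity `V` against a space–time test field `ψ` amounts to testing the original field against the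
TRANSPORTED test field `ψ̃ t x := ψ t (x - [tV])`.  This file records the test-field side of that
computation:

* `Torus.fderiv_comp_sub`, `Torus.laplacian_comp_sub`, `Torus.divergence_comp_sub` — the space operators of a
  translate `x ↦ g (x - a)` are those of `g` at `x - a`;
* `Torus.isSpaceTimeTest_comp_sub_proj_smul`, `Torus.isDivFreeTest_comp_sub_proj_smul` — `ψ̃` is again a (divergence-free)
  space–time test field on `[0, T)` (its lift is `stLift ψ` composed with the smooth shear `(t, ỹ) ↦ (t, ỹ - tV)`);
* `Torus.timeDeriv_comp_sub_proj_smul` — the chain rule `∂ₜψ̃(t, x) = ∂ₜψ(t, y) - Dψₜ(y)[V]`, `y = x - [tV]`;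
* the FRAME TERMS vanish slice-wise: `∫ ⟪V, Dφ(y)[w y]⟫ dy = 0` for weakly divergence-free `w`
  (`⟪V, Dφ w⟫ = ⟪w, ∇⟪V, φ⟫⟫`), `∫ ⟪V, Dφ[V]⟫ = 0` and `∫ ⟪V, Δφ⟫ = 0` (periodicity);
* `Torus.setIntegral_integral_inner_timeDeriv_const` — `∫_{(0,T)} ∫ ⟪V, ∂ₜψ⟫ = -∫ ⟪V, ψ 0⟫` (the frame term
  integrates in time to the datum term).

All of this is standard calculus behind the Galilean invariance of the Navier–Stokes equations
(U. Frisch, *Turbulence* (1995), §2.2; weak formulation: R. Temam, *Navier–Stokes Equations* (1984),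
Ch. III §1.1).
-/

noncomputable section

open MeasureTheory Set Filter Topology
open scoped InnerProductSpace RealInnerProductSpace ENNReal NNReal ContDiff

namespace Literature.Analysis.FluidPDE.Torus

open Literature.Analysis.FunctionSpaces Literature.Analysis.FunctionSpaces.Torus UnitAddTorus

variable {d : Type*} [Fintype d] [DecidableEq d]

/-! ### Space operators of a translate `x ↦ g (x - a)` -/

section Translate

variable {F : Type*} [NormedAddCommGroup F] [NormedSpace ℝ F]

omit [Fintype d] [DecidableEq d] [NormedAddCommGroup F] [NormedSpace ℝ F] in
/-- Re-centred lift of a translate: `liftAt (g (· - a)) x = liftAt g (x - a)`. [folklore] -/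
theorem liftAt_comp_sub (g : UnitAddTorus d → F) (a x : UnitAddTorus d) :
    liftAt (fun z => g (z - a)) x = liftAt g (x - a) := by
  funext v
  simp only [liftAt_apply, add_sub_right_comm]

omit [Fintype d] [DecidableEq d] in
/-- The torus Fréchet derivative of `x ↦ g (x - a)` is that of `g` at `x - a`. [folklore] -/
theorem fderiv_comp_sub (g : UnitAddTorus d → F) (a x : UnitAddTorus d) :
    Torus.fderiv (fun z => g (z - a)) x = Torus.fderiv g (x - a) := by
  simp only [Torus.fderiv, liftAt_comp_sub]

omit [DecidableEq d] in
/-- The torus Laplacian of `x ↦ g (x - a)` is that of `g` at `x - a`. [folklore] -/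
theorem laplacian_comp_sub (g : UnitAddTorus d → F) (a x : UnitAddTorus d) :
    Torus.laplacian (fun z => g (z - a)) x = Torus.laplacian g (x - a) := by
  simp only [Torus.laplacian, liftAt_comp_sub]

/-- The torus divergence of `x ↦ g (x - a)` is that of `g` at `x - a` (no differentiability
needed). [folklore] -/
theorem divergence_comp_sub (g : UnitAddTorus d → EuclideanSpace ℝ d) (a x : UnitAddTorus d) :
    Torus.divergence (fun z => g (z - a)) x = Torus.divergence g (x - a) := by
  simp only [Torus.divergence, Torus.partialDeriv, Torus.lineDeriv, add_sub_right_comm]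

end Translate

/-! ### Transport of test fields along the frame: `ψ̃ t x = ψ t (x - [tV])` -/

section TestTransport

variable {F : Type*} [NormedAddCommGroup F] [NormedSpace ℝ F]

omit [DecidableEq d] in
/-- The transported field `(t, x) ↦ ψ t (x - [tV])` of a space–time test field on `[0, T)` is a
space–time test field on `[0, T)`: its lift is `stLift ψ ∘ ((t, ỹ) ↦ (t, ỹ - tV))`, a smooth shear,
and the time support is unchanged. [folklore] -/
theorem isSpaceTimeTest_comp_sub_proj_smul {T : ℝ} {ψ : ℝ → UnitAddTorus d → F}
    (hψ : IsSpaceTimeTest T ψ) (V : EuclideanSpace ℝ d) :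
    IsSpaceTimeTest T (fun s z => ψ s (z - proj (s • V))) := by
  obtain ⟨hs, T', hT', h0⟩ := hψ
  refine ⟨?_, T', hT', fun t ht => ?_⟩
  · have hst : stLift (fun s z => ψ s (z - proj (s • V))) =
        stLift ψ ∘ fun z : ℝ × EuclideanSpace ℝ d => (z.1, z.2 - z.1 • V) := by
      funext z
      rfl
    rw [hst]
    exact hs.comp (contDiff_fst.prodMk (contDiff_snd.sub (contDiff_fst.smul contDiff_const)))
  · funext z
    simp [h0 t ht]

/-- The transported field of a divergence-free test field is divergence free. [folklore] -/
theorem isDivFreeTest_comp_sub_proj_smul {ψ : ℝ → UnitAddTorus d → EuclideanSpace ℝ d}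
    (hψ : IsDivFreeTest ψ) (V : EuclideanSpace ℝ d) :
    IsDivFreeTest (fun s z => ψ s (z - proj (s • V))) := by
  intro t x
  rw [divergence_comp_sub]
  exact hψ t _

omit [DecidableEq d] in
/-- **Chain rule for the transported test field** (direction `(1, -V)` along
`τ ↦ (τ, ỹ - τV)`): `∂ₜ(ψ(·, · - [·V]))(t, x) = ∂ₜψ(t, y) - Dψₜ(y)[V]`, `y = x - [tV]`. [folklore] -/
theorem timeDeriv_comp_sub_proj_smul {ψ : ℝ → UnitAddTorus d → F} (hψ : ContDiff ℝ ∞ (stLift ψ))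
    (V : EuclideanSpace ℝ d) (t : ℝ) (x : UnitAddTorus d) :
    Torus.timeDeriv (fun s z => ψ s (z - proj (s • V))) t x =
      Torus.timeDeriv ψ t (x - proj (t • V)) - Torus.fderiv (ψ t) (x - proj (t • V)) V := by
  obtain ⟨y, rfl⟩ := proj_surjective x
  have hψu : Torus.IsSmoothSpaceTimeOn univ ψ := hψ.contDiffOn
  have hγ : HasDerivAt (fun τ : ℝ => ((τ, y - τ • V) : ℝ × EuclideanSpace ℝ d)) ((1 : ℝ), -V) t := by
    have h1 : HasDerivAt (fun τ : ℝ => y - τ • V) (-V) t := by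
      simpa using ((hasDerivAt_id t).smul_const V).const_sub y
    exact (hasDerivAt_id t).prodMk h1
  have hF : HasFDerivAt (stLift ψ) (_root_.fderiv ℝ (stLift ψ) (t, y - t • V)) (t, y - t • V) :=
    ((hψ.differentiable (by simp)) _).hasFDerivAt
  have hcomp := hF.comp_hasDerivAt t hγ
  have hfun : (fun τ => (fun s z => ψ s (z - proj (s • V))) τ (proj y)) =
      stLift ψ ∘ fun τ : ℝ => ((τ, y - τ • V) : ℝ × EuclideanSpace ℝ d) := by
    funext τ
    rfl
  have hlhs : Torus.timeDeriv (fun s z => ψ s (z - proj (s • V))) t (proj y) =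
      _root_.fderiv ℝ (stLift ψ) (t, y - t • V) ((1 : ℝ), -V) := by
    unfold Torus.timeDeriv
    rw [hfun, hcomp.deriv]
  have hsplit : (((1 : ℝ), -V) : ℝ × EuclideanSpace ℝ d) =
      ((1 : ℝ), (0 : EuclideanSpace ℝ d)) - ((0 : ℝ), V) := by
    rw [Prod.mk_sub_mk, sub_zero, zero_sub]
  have hy : proj y - proj (t • V) = proj (y - t • V) := rfl
  have h1 : Torus.timeDeriv ψ t (proj (y - t • V)) =
      _root_.fderiv ℝ (stLift ψ) (t, y - t • V) ((1 : ℝ), (0 : EuclideanSpace ℝ d)) := by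
    rw [← timeDerivWithin_eq_timeDeriv_of_contDiff hψ uniqueDiffOn_univ (mem_univ t),
      hψu.timeDerivWithin_apply_proj uniqueDiffOn_univ (mem_univ t), univ_prod_univ, fderivWithin_univ]
  have h2 : Torus.fderiv (ψ t) (proj (y - t • V)) V =
      _root_.fderiv ℝ (stLift ψ) (t, y - t • V) ((0 : ℝ), V) := by
    rw [hψu.fderiv_slice_apply (mem_univ t), univ_prod_univ, fderivWithin_univ]
  rw [hlhs, hsplit, map_sub, hy, h1, h2]

omit [Fintype d] [DecidableEq d] [NormedAddCommGroup F] [NormedSpace ℝ F] in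
/-- The transported field at time `0` is the original slice: `[0 · V] = 0`. [folklore] -/
theorem comp_sub_proj_smul_zero (ψ : ℝ → UnitAddTorus d → F) (V : EuclideanSpace ℝ d) :
    (fun s z => ψ s (z - proj (s • V))) 0 = ψ 0 := by
  funext z
  simp

end TestTransport

/-! ### The frame terms vanish slice-wise -/

section FrameTerms

omit [DecidableEq d] in
/-- `⟪V, Dφ(y) w⟫ = ⟪w, ∇⟪V, φ⟫(y)⟫`: pairing a derivative with a constant vector is testing
against the gradient of the scalar `⟪V, φ⟫`. [folklore] -/
theorem inner_fderiv_apply_eq_inner_gradient {φ : UnitAddTorus d → EuclideanSpace ℝ d}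
    (hφ : IsSmooth φ) (V w : EuclideanSpace ℝ d) (y : UnitAddTorus d) :
    ⟪V, Torus.fderiv φ y w⟫ = ⟪w, Torus.gradient (fun z => ⟪V, φ z⟫) y⟫ := by
  have hc : IsContDiff 1 (fun _ : UnitAddTorus d => V) := contDiff_const
  have h0 : Torus.fderiv (fun _ : UnitAddTorus d => V) y = 0 := by
    change _root_.fderiv ℝ (fun _ : EuclideanSpace ℝ d => V) 0 = 0
    simp
  calc ⟪V, Torus.fderiv φ y w⟫ = Torus.fderiv (fun z => ⟪V, φ z⟫) y w := by
        rw [Torus.fderiv_inner_apply hc (hφ.isContDiff (by simp)), h0]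
        simp
    _ = ⟪w, Torus.gradient (fun z => ⟪V, φ z⟫) y⟫ := by
        rw [← Torus.inner_gradient_left]
        exact real_inner_comm _ _

omit [DecidableEq d] in
/-- **The convective frame term vanishes**: `∫ ⟪V, Dφ(y)[w y]⟫ dy = 0` for a weakly
divergence-free `w` and smooth `φ` (test `⟪V, φ⟫` against `w`). [folklore] -/
theorem integral_inner_fderiv_apply_eq_zero_of_isWeaklyDivFree {w φ : UnitAddTorus d → EuclideanSpace ℝ d}
    (hw : Torus.IsWeaklyDivFree w) (hφ : IsSmooth φ) (V : EuclideanSpace ℝ d) :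
    ∫ y, ⟪V, Torus.fderiv φ y (w y)⟫ = 0 := by
  simp_rw [inner_fderiv_apply_eq_inner_gradient hφ]
  exact hw _ ((isSmooth_const V).inner hφ)

omit [DecidableEq d] in
/-- **The drift term vanishes**: `∫ ⟪V, Dφ(y)[V]⟫ dy = 0` for smooth `φ` (`∫ ∂_V φ = 0` by
periodicity). [folklore] -/
theorem integral_inner_fderiv_apply_const_eq_zero {φ : UnitAddTorus d → EuclideanSpace ℝ d}
    (hφ : IsSmooth φ) (V : EuclideanSpace ℝ d) : ∫ y, ⟪V, Torus.fderiv φ y V⟫ = 0 := by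
  have h1 : (fun y => Torus.fderiv φ y V) = fun y => Torus.lineDeriv φ y V :=
    funext fun y => (lineDeriv_eq_fderiv_apply (hφ.isContDiff (by simp)) y V).symm
  rw [integral_inner (by rw [h1]; exact (hφ.lineDeriv V).integrable) V, h1,
    integral_lineDeriv_eq_zero hφ V, inner_zero_right]

/-- **The viscous frame term vanishes**: `∫ ⟪V, Δφ⟫ = 0` for smooth `φ` (`∫ Δφ = 0`). [folklore] -/
theorem integral_inner_laplacian_const_eq_zero {φ : UnitAddTorus d → EuclideanSpace ℝ d}
    (hφ : IsSmooth φ) (V : EuclideanSpace ℝ d) : ∫ y, ⟪V, Torus.laplacian φ y⟫ = 0 := by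
  rw [integral_inner hφ.laplacian.integrable V, integral_laplacian_eq_zero_of_isSmooth hφ,
    inner_zero_right]

end FrameTerms

/-! ### The frame term integrates to the datum -/

section FrameTime

omit [DecidableEq d] in
/-- **The frame term integrates to the datum**: for a space–time test field `ψ` on `[0, T)` and a
constant `V`, `∫_{(0,T)} ∫ ⟪V, ∂ₜψ⟫ = -∫ ⟪V, ψ(0)⟫` (differentiate `t ↦ ∫⟪V, ψ t⟫` under the integral
and use `ψ(T) = 0`). [folklore] -/
theorem setIntegral_integral_inner_timeDeriv_const {T : ℝ} {ψ : ℝ → UnitAddTorus d → EuclideanSpace ℝ d}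
    (hψ : IsSpaceTimeTest T ψ) (V : EuclideanSpace ℝ d) :
    ∫ t in Ioo 0 T, ∫ y, ⟪V, Torus.timeDeriv ψ t y⟫ = -∫ y, ⟪V, ψ 0 y⟫ := by
  obtain ⟨hs, T', hT'T, hT'⟩ := id hψ
  have hVc : Torus.IsSmoothSpaceTimeOn univ (fun (_ : ℝ) (_ : UnitAddTorus d) => V) :=
    isSmoothSpaceTimeOn_const (isSmooth_const V) univ
  have hψu : Torus.IsSmoothSpaceTimeOn univ ψ := hs.contDiffOn
  have hθ : Torus.IsSmoothSpaceTimeOn univ (fun t y => ⟪V, ψ t y⟫) := hVc.inner hψu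
  have hθ' : ∀ t y, Torus.timeDerivWithin univ (fun t y => ⟪V, ψ t y⟫) t y = ⟪V, Torus.timeDeriv ψ t y⟫ := by
    intro t y
    rw [hVc.timeDerivWithin_inner hψu uniqueDiffOn_univ (mem_univ t),
      timeDerivWithin_eq_timeDeriv_of_contDiff hs uniqueDiffOn_univ (mem_univ t)]
    simp [Torus.timeDerivWithin]
  have hPd : ∀ t, HasDerivAt (fun s => ∫ y, ⟪V, ψ s y⟫) (∫ y, ⟪V, Torus.timeDeriv ψ t y⟫) t := by
    intro t
    have h := (hθ.hasDerivWithinAt_integral convex_univ (mem_univ t)).hasDerivAt univ_mem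
    simp only [hθ'] at h
    exact h
  have hCc : Continuous fun t => ∫ y, ⟪V, Torus.timeDeriv ψ t y⟫ := by
    have hθ2 : Torus.IsSmoothSpaceTimeOn univ (fun t y => ⟪V, Torus.timeDeriv ψ t y⟫) :=
      hVc.inner (hψ.timeDeriv.isSmoothSpaceTimeOn univ)
    exact continuousOn_univ.1 (hθ2.continuousOn_integral convex_univ)
  rcases le_or_gt T 0 with hT | hT
  · have hψ0 : ψ 0 = 0 := hT' 0 (by linarith)
    rw [Ioo_eq_empty (not_lt.2 hT), Measure.restrict_empty, integral_zero_measure, hψ0]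
    simp
  · rw [← integral_Ioc_eq_integral_Ioo, ← intervalIntegral.integral_of_le hT.le,
      intervalIntegral.integral_eq_sub_of_hasDerivAt (fun t _ => hPd t) (hCc.intervalIntegrable _ _)]
    have hψT : ψ T = 0 := hT' T hT'T.le
    simp [hψT]

end FrameTime

end Literature.Analysis.FluidPDE.Torus

end
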